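import Literature.AnabelianGeometry.EtaleTheta.ThetaSettingOriginClauses
import Mathlib.GroupTheory.CosetCover
import HarnessLib

/-!
# [EtTh] §1: at a joint origin, `Δ^tp_{Y_N}` IS the `N`-th-power locus of `(Δ^tp_Y)^ell` and the inertia of
# every cusp of `Y` is an `N`-th power in `(Δ^tp_Y)^ell` for every `N` (interface law over the frozen root)

Mochizuki, *The étale theta function and its Frobenioid-theoretic manifestations*, Publ. RIMS **45** (2009) [EtTh],
§1, kurims PDF p. 13 «`1 → (Δ^tp_Y)^ell ⊗ ℤ/Nℤ → Gal(Y_N/Y) → Gal(K_N/K) → 1`», «any decomposition group of a cusp of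
`Y^log` determines, up to conjugation by `(Δ^tp_Y)^ell`, a section `G_K → (Π^tp_Y)^ell` […] whose restriction to the
open subgroup `G_{K_N} ⊆ G_K` determines an open immersion `G_{K_N} ↪ (Π^tp_Y)^ell/N·(Δ^tp_Y)^ell` […] this image
determines a Galois covering `Y_N → Y`», p. 16 «`Δ^tp_Y/Δ^tp_{Y_N} ≅ ℤ/Nℤ(1)`» [cite: MochizukiEtTh2009, §1 p.13];
[SemiAnbd] §6 p. 71 «`I_x` is isomorphic to `Ẑ(1)` if `x` is a cusp» [cite: MochizukiSemiAnbd2006, §6 p.71].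
abc-iut cell, layer L2, seat abc-iut-w5-d051 (gen 4; R78 origin-profile / NV-census lineage — author of the clause
text TM of abc-iut-L2-t6's `ThetaSetting.IsTateOrigin` / `IsThm16Origin.tate2`), STATUS row «JOINT-ORIGIN CUSP LAW».

WHAT. Three printed clauses of §1 are carried by the cell as NAMED hypotheses on a `D : ThetaSetting p`: the
Tate-module clause (TM) of `ThetaSetting.IsTateOrigin` (at level `N`: a generator `y₁` of `(Δ^tp_Y)^ell` modulo
`N·(Δ^tp_Y)^ell`, clause (a)), the printed CONSTRUCTION of `Y_N` from a cusp section (R2,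
abc-iut-L6-d5's `Thm16Sub.GtpYNFromCusp D N`), and the existence of a cusp of `X^log` whose decomposition group lies
in `Π^tp_Y` (the cusp field of `ThetaSetting.IsThm16Origin`).  This PROOF-ONLY file derives, over the frozen root
interface and for ANY `D`, what these three clauses force TOGETHER with the root axiom `relIndex_deltaYN`
(«`[Δ^tp_Y : Δ^tp_{Y_N}] = N`»):

* `ThetaSetting.dtpY_inf_comap_ellPowersY_le_dtpYN` — R2 (⇐) alone: every element of `Δ^tp_Y` whose ell-image lies in
  `N·(Δ^tp_Y)^ell` lies in `Δ^tp_{Y_N}` (given one cusp inside `Π^tp_Y` to instantiate R2);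
* `ThetaSetting.relIndex_comap_ellPowersY_le` / `…_ne_zero` — clause (a) alone: `Δ^tp_Y` is covered by the `N` cosets
  `y₁^k · {y | y^ell ∈ N·(Δ^tp_Y)^ell}`, `k < N` (Mathlib's `Subgroup.index_le_of_leftCoset_cover_const`);
* **`ThetaSetting.dtpYN_eq_dtpY_inf_comap_ellPowersY`** — hence, with `relIndex_deltaYN` and the multiplicativity of
  relative indices, `Δ^tp_{Y_N} = {y ∈ Δ^tp_Y | y^ell ∈ N·(Δ^tp_Y)^ell}`: the printed «`Δ^tp_Y/Δ^tp_{Y_N} ≅ ℤ/Nℤ(1)`»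
  (p. 16) as a CHARACTERISATION of the datum `GtpYN N` on its geometric part;
* **`ThetaSetting.map_toEll_inertia_le_ellPowersY`** — and for EVERY cuspidal decomposition group `Dc ⊆ Π^tp_Y`, the
  inertia `Dc ∩ Δ^tp_X` has ell-image inside `N·(Δ^tp_Y)^ell`: the inertia of a cusp of `Y` is an `N`-th power in
  `(Δ^tp_Y)^ell`;
* the packaged forms `ThetaSetting.IsTateOrigin.dtpYN_eq` / `.map_toEll_inertia_le_ellPowersY` /
  `.map_toEll_inertia_le_iInf_ellPowersY` (every `N`, from `IsTateOrigin` + R2 for every `N` + one cusp in `Π^tp_Y`),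
  `ThetaSetting.dtpYN_eq_of_origins` / `map_toEll_inertia_le_iInf_ellPowersY_of_origins` (from the conjunction
  `IsThm16Origin ∧ IsTateOrigin`), the level-`2` form `ThetaSetting.IsThm16Origin.map_toEll_inertia_le_ellPowersY_two`
  (from `IsThm16Origin` ALONE: (TM₂) + R2 + its own cusp — the inertia of a cusp of `Y` is a square in `(Δ^tp_Y)^ell`,
  i.e. dies in `Gal(Ÿ/Y)`), and `ThetaSetting.inertia_le_ker_toEll_of_separated` — if no non-trivial element of
  `(Δ^tp_Y)^ell` is an `N`-th power for every `N` (true at every `Ẑ`-coordinatised model of the cell and at genuine data,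
  «`(Δ^tp_Y)^ell ≅ Ẑ(1)`»), the inertia of every cusp of `Y` lies in `Ker(Π^tp_X ↠ (Π^tp_X)^ell) =
  toHat⁻¹(closure [Δ_X, Δ_X])` (root field `ker_toEll`): in print, the COMMUTATOR axis.

WHY (NV census of the origin predicates, abc-iut-L2-lead 13:00Z v-next; HOME/staging/w5/w5-d051/g3/MANIFEST.md).  The
conjunction `IsThm16Origin ∧ IsTateOrigin` has NO inhabitant among the cell's semi-synthetic models
(`SettingModel.no_joint_isThm16Origin_isTateOrigin_in_zoo`): the cusped stage-2 twin `modelχq′` satisfies `IsTateOrigin`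
and fails R2 (`SettingModel.not_gtpYNFromCusp_modelχq'`), the Krull carrier `modelκ′` satisfies `IsThm16Origin` and
fails (TM).  The present law is the STRUCTURAL form of the first failure — a synthetic cusp placed on the toral axis
`b^Ẑ` has inertia mapping ONTO `(Δ^tp_Y)^ell`, which the law forbids — and the first interface-level constraint on
any future joint inhabitant: its cusp inertia must lie in the commutator part of `Δ^tp_X`, on whose image in the
class-two quotient every Galois section acts through the cyclotomic character (determinant of the action on
`(Δ^tp_X)^ell`), so that a joint model requires automorphisms of the free profinite `Δ_X` of determinant `χ(σ) ∉ {±1}`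
normalising the cusp-inertia class — data of Grothendieck–Teichmüller type, not available in the affine family of
the cell's models.  PROOF-ONLY: no definition, no instance, no named fact; plain group theory over the frozen root
`ThetaSetting` and abc-iut-L6-d5's `Thm16Sub` vocabulary (`toEll`, `ellPowersY`, `GtpYNFromCusp`), nothing restated.
HONEST FRAMING: the origin predicates are hypotheses (inhabited only at models); nothing of [EtTh]/[SemiAnbd] is
asserted for genuine tempered fundamental groups; no side is taken on [IUTchIII] Cor. 3.12; typed ≠ proved.
-/

noncomputable section

namespace Literature.AnabelianGeometry.EtaleTheta

open Literature.AnabelianGeometry.SemiGraphs Thm16Sub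
open scoped Pointwise

namespace ThetaSetting

variable {p : ℕ} [Fact p.Prime] (D : ThetaSetting p)

/-! ### 1. R2 (⇐): the `N`-th-power locus of `Δ^tp_Y` lies in `Δ^tp_{Y_N}` -/

/-- `Δ^tp_{Y_N} ⊆ Δ^tp_Y` (`Y_N → Y`, p. 13). [cite: MochizukiEtTh2009, §1 p.13] -/
theorem dtpYN_le_dtpY (N : ℕ+) : D.DtpYN N ≤ D.DtpY :=
  inf_le_inf_right _ (D.GtpYN_le N)

/-- The root axiom «`Δ^tp_Y/Δ^tp_{Y_N} ≅ ℤ/Nℤ(1)`» in the `DtpYN`/`DtpY` vocabulary: `[Δ^tp_Y : Δ^tp_{Y_N}] = N`.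
[cite: MochizukiEtTh2009, §1 p.16] -/
theorem relIndex_dtpYN_dtpY (N : ℕ+) : (D.DtpYN N).relIndex D.DtpY = N :=
  D.relIndex_deltaYN N

/-- **R2 (⇐).** If `Π^tp_{Y_N}` is the subgroup print constructs from a cusp section (`Thm16Sub.GtpYNFromCusp D N`)
and some cuspidal decomposition group lies in `Π^tp_Y` (a curve of type `(1,1)` has a cusp, p. 12), then every
`y ∈ Δ^tp_Y` whose image in `(Π^tp_X)^ell` lies in `N·(Δ^tp_Y)^ell` lies in `Δ^tp_{Y_N}` (its augmentation is
`1 ∈ G_{K_N}`). [cite: MochizukiEtTh2009, §1 p.13] -/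
theorem dtpY_inf_comap_ellPowersY_le_dtpYN (N : ℕ+) (hR2 : GtpYNFromCusp D N)
    (hcusp : ∃ Dc : Subgroup D.PiTemp, D.IsCuspidalDecompositionGroup Dc ∧ Dc ≤ D.GtpY) :
    D.DtpY ⊓ (ellPowersY D N).comap (toEll D) ≤ D.DtpYN N := by
  obtain ⟨Dc, hDc, hDcY⟩ := hcusp
  intro g hg
  obtain ⟨hgYΔ, hgP⟩ := Subgroup.mem_inf.mp hg
  obtain ⟨hgY, hgΔ⟩ := Subgroup.mem_inf.mp hgYΔ
  have hgP : toEll D g ∈ ellPowersY D N := Subgroup.mem_comap.mp hgP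
  have h1 : D.aug g = 1 := (MonoidHom.mem_ker).mp hgΔ
  refine Subgroup.mem_inf.mpr ⟨(hR2 Dc hDc hDcY g).mpr ⟨hgY, ?_, Subgroup.mem_sup_right hgP⟩, hgΔ⟩
  rw [h1]
  exact one_mem _

/-! ### 2. Clause (a) of (TM): `Δ^tp_Y` is covered by `N` cosets of the `N`-th-power locus -/

section Cover

variable {D} {N : ℕ+} {y₁ : D.PiTemp}

/-- `(y₁^ell)^N ∈ N·(Δ^tp_Y)^ell` for `y₁ ∈ Δ^tp_Y` (an `N`-th power of an element of `(Δ^tp_Y)^ell`).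
[cite: MochizukiEtTh2009, §1 p.13] -/
theorem toEll_pow_mem_ellPowersY (hy₁ : y₁ ∈ D.DtpY) :
    toEll D y₁ ^ (N : ℕ) ∈ ellPowersY D N :=
  Subgroup.subset_closure ⟨toEll D y₁, ⟨y₁, hy₁, rfl⟩, rfl⟩

/-- **Clause (a) ⇒ coset cover.** If `y₁ ∈ Δ^tp_Y` generates `(Δ^tp_Y)^ell` modulo `N·(Δ^tp_Y)^ell` (clause (a) of the
Tate-module clause at level `N`), then `Δ^tp_Y` is the union of the `N` left cosets `y₁^k · {y | y^ell ∈ N·(Δ^tp_Y)^ell}`,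
`k < N` (inside the group `Δ^tp_Y`; `(Δ^tp_X)^ell` is abelian, abc-iut-w5-d051's `Thm16Sub.toEll_comm_of_mem_delta`).
[cite: MochizukiEtTh2009, §1 p.13] -/
theorem iUnion_leftCoset_comap_ellPowersY_eq_univ (hy₁ : y₁ ∈ D.DtpY)
    (ha : ∀ y ∈ D.DtpY, ∃ k : ℕ, toEll D y * (toEll D y₁ ^ k)⁻¹ ∈ ellPowersY D N) :
    ⋃ k ∈ Finset.range (N : ℕ),
        ((⟨y₁, hy₁⟩ : D.DtpY) ^ k) • ((((ellPowersY D N).comap (toEll D)).subgroupOf D.DtpY : Subgroup D.DtpY) :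
          Set D.DtpY) = Set.univ := by
  refine Set.eq_univ_of_forall fun x => ?_
  obtain ⟨k, hk⟩ := ha x x.2
  simp only [Set.mem_iUnion, Finset.mem_range, exists_prop]
  refine ⟨k % N, Nat.mod_lt _ N.pos, ?_⟩
  rw [mem_leftCoset_iff, SetLike.mem_coe, Subgroup.mem_subgroupOf, Subgroup.mem_comap]
  have hcoe : (((((⟨y₁, hy₁⟩ : D.DtpY) ^ (k % (N : ℕ)))⁻¹ * x : D.DtpY)) : D.PiTemp) =
      (y₁ ^ (k % (N : ℕ)))⁻¹ * (x : D.PiTemp) := by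
    simp only [Subgroup.coe_mul, Subgroup.coe_inv, Subgroup.coe_pow]
  rw [hcoe, map_mul, map_inv, map_pow]
  -- abbreviations
  set t : D.GtpEll := toEll D y₁ with ht
  set e : D.GtpEll := toEll D (x : D.PiTemp) with he
  have hc : Commute t e := toEll_comm_of_mem_delta D hy₁.2 x.2.2
  have hN : t ^ (N : ℕ) ∈ ellPowersY D N := toEll_pow_mem_ellPowersY hy₁
  have hsplit : t ^ k = t ^ ((N : ℕ) * (k / N)) * t ^ (k % (N : ℕ)) := by
    rw [← pow_add, Nat.div_add_mod]
  have key : (t ^ (k % (N : ℕ)))⁻¹ * e = e * (t ^ k)⁻¹ * (t ^ (N : ℕ)) ^ (k / N) := by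
    rw [((hc.pow_left (k % (N : ℕ))).inv_left).eq, hsplit, mul_inv_rev, ← pow_mul, mul_assoc, mul_assoc,
      inv_mul_cancel, mul_one]
  rw [key]
  exact (ellPowersY D N).mul_mem hk ((ellPowersY D N).pow_mem hN _)

/-- **Clause (a) ⇒ `[Δ^tp_Y : {y | y^ell ∈ N·(Δ^tp_Y)^ell}] ≤ N`.** [cite: MochizukiEtTh2009, §1 p.13] -/
theorem relIndex_comap_ellPowersY_le (hy₁ : y₁ ∈ D.DtpY)
    (ha : ∀ y ∈ D.DtpY, ∃ k : ℕ, toEll D y * (toEll D y₁ ^ k)⁻¹ ∈ ellPowersY D N) :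
    ((ellPowersY D N).comap (toEll D)).relIndex D.DtpY ≤ N := by
  have h := Subgroup.index_le_of_leftCoset_cover_const (iUnion_leftCoset_comap_ellPowersY_eq_univ hy₁ ha)
  rwa [Finset.card_range] at h

/-- **Clause (a) ⇒ the locus has FINITE index in `Δ^tp_Y`** (`relIndex ≠ 0`). [cite: MochizukiEtTh2009, §1 p.13] -/
theorem relIndex_comap_ellPowersY_ne_zero (hy₁ : y₁ ∈ D.DtpY)
    (ha : ∀ y ∈ D.DtpY, ∃ k : ℕ, toEll D y * (toEll D y₁ ^ k)⁻¹ ∈ ellPowersY D N) :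
    ((ellPowersY D N).comap (toEll D)).relIndex D.DtpY ≠ 0 :=
  (Subgroup.finiteIndex_of_leftCoset_cover_const
    (iUnion_leftCoset_comap_ellPowersY_eq_univ hy₁ ha)).index_ne_zero

end Cover

/-! ### 3. The characterisation of `Δ^tp_{Y_N}` and the law for cusp inertia -/

/-- **`Δ^tp_{Y_N}` IS the `N`-th-power locus** («`Δ^tp_Y/Δ^tp_{Y_N} ≅ ℤ/Nℤ(1)`», p. 16, as a characterisation): from
clause (a) of (TM) at level `N` (generator `y₁`), R2 at level `N`, one cusp inside `Π^tp_Y`, and the root axiom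
`relIndex_deltaYN`: `Δ^tp_{Y_N} = {y ∈ Δ^tp_Y | y^ell ∈ N·(Δ^tp_Y)^ell}` — the locus lies in `Δ^tp_{Y_N}` (§1), has index
`≤ N` and `≠ 0` in `Δ^tp_Y` (§2), while `Δ^tp_{Y_N}` has index exactly `N`, so the multiplicativity of relative indices
leaves no room. [cite: MochizukiEtTh2009, §1 p.16] -/
theorem dtpYN_eq_dtpY_inf_comap_ellPowersY (N : ℕ+) {y₁ : D.PiTemp} (hy₁ : y₁ ∈ D.DtpY)
    (ha : ∀ y ∈ D.DtpY, ∃ k : ℕ, toEll D y * (toEll D y₁ ^ k)⁻¹ ∈ ellPowersY D N)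
    (hR2 : GtpYNFromCusp D N)
    (hcusp : ∃ Dc : Subgroup D.PiTemp, D.IsCuspidalDecompositionGroup Dc ∧ Dc ≤ D.GtpY) :
    D.DtpYN N = D.DtpY ⊓ (ellPowersY D N).comap (toEll D) := by
  set E : Subgroup D.PiTemp := D.DtpY ⊓ (ellPowersY D N).comap (toEll D) with hE
  have hEYN : E ≤ D.DtpYN N := D.dtpY_inf_comap_ellPowersY_le_dtpYN N hR2 hcusp
  have hYNY : D.DtpYN N ≤ D.DtpY := D.dtpYN_le_dtpY N
  have hEY : E.relIndex D.DtpY = ((ellPowersY D N).comap (toEll D)).relIndex D.DtpY :=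
    Subgroup.inf_relIndex_left _ _
  have hle : E.relIndex D.DtpY ≤ N := hEY ▸ relIndex_comap_ellPowersY_le hy₁ ha
  have hne : E.relIndex D.DtpY ≠ 0 := hEY ▸ relIndex_comap_ellPowersY_ne_zero hy₁ ha
  have hmul : E.relIndex (D.DtpYN N) * (N : ℕ) = E.relIndex D.DtpY := by
    rw [← D.relIndex_dtpYN_dtpY N]
    exact Subgroup.relIndex_mul_relIndex E (D.DtpYN N) D.DtpY hEYN hYNY
  have hone : E.relIndex (D.DtpYN N) = 1 := by
    have hpos : 0 < E.relIndex (D.DtpYN N) := by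
      rcases Nat.eq_zero_or_pos (E.relIndex (D.DtpYN N)) with h0 | h0
      · exact absurd (by rw [← hmul, h0, zero_mul]) hne
      · exact h0
    have hle1 : E.relIndex (D.DtpYN N) * (N : ℕ) ≤ 1 * (N : ℕ) := by
      rw [hmul, one_mul]; exact hle
    have := Nat.le_of_mul_le_mul_right hle1 N.pos
    omega
  exact le_antisymm (Subgroup.relIndex_eq_one.mp hone) hEYN

/-- **The inertia of every cusp of `Y` is an `N`-th power in `(Δ^tp_Y)^ell`.** Under the hypotheses of
`dtpYN_eq_dtpY_inf_comap_ellPowersY` at level `N` (clause (a) of (TM), R2), for EVERY cuspidal decomposition group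
`Dc ⊆ Π^tp_Y` the image of `Dc ∩ Δ^tp_X` in `(Π^tp_X)^ell` lies in `N·(Δ^tp_Y)^ell`: by R2 (⇐) the inertia lies in
`Π^tp_{Y_N}` (its own ell-image witnessing the cusp-section condition), and `Δ^tp_{Y_N}` is the `N`-th-power locus.
In print the inertia of a cusp is the commutator axis, which dies in `(Δ^tp_Y)^ell`; a synthetic cusp on the toral
axis violates this law (the cell's `modelχ′`/`modelχq′`). [cite: MochizukiEtTh2009, §1 p.13] -/
theorem map_toEll_inertia_le_ellPowersY (N : ℕ+) {y₁ : D.PiTemp} (hy₁ : y₁ ∈ D.DtpY)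
    (ha : ∀ y ∈ D.DtpY, ∃ k : ℕ, toEll D y * (toEll D y₁ ^ k)⁻¹ ∈ ellPowersY D N)
    (hR2 : GtpYNFromCusp D N) {Dc : Subgroup D.PiTemp} (hDc : D.IsCuspidalDecompositionGroup Dc)
    (hDcY : Dc ≤ D.GtpY) :
    (Dc ⊓ D.DeltaTemp).map (toEll D) ≤ ellPowersY D N := by
  rintro _ ⟨g, hg, rfl⟩
  obtain ⟨hgc, hgΔ⟩ := Subgroup.mem_inf.mp hg
  have h1 : D.aug g = 1 := (MonoidHom.mem_ker).mp hgΔ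
  have hK : g ∈ Dc ⊓ (D.GKN N).comap D.aug.toMonoidHom := by
    refine Subgroup.mem_inf.mpr ⟨hgc, Subgroup.mem_comap.mpr ?_⟩
    change D.aug g ∈ D.GKN N
    rw [h1]
    exact one_mem _
  have hYN : g ∈ D.GtpYN N :=
    (hR2 Dc hDc hDcY g).mpr ⟨hDcY hgc, hK.2, Subgroup.mem_sup_left ⟨g, hK, rfl⟩⟩
  have hg : g ∈ D.DtpYN N := Subgroup.mem_inf.mpr ⟨hYN, hgΔ⟩
  rw [D.dtpYN_eq_dtpY_inf_comap_ellPowersY N hy₁ ha hR2 ⟨Dc, hDc, hDcY⟩] at hg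
  exact hg.2

/-! ### 4. Packaged forms: from `IsTateOrigin` (+ R2, cusp), from `IsThm16Origin ∧ IsTateOrigin`, from `IsThm16Origin` at `N = 2` -/

/-- **`IsTateOrigin` + R2 for every `N` + one cusp in `Π^tp_Y` ⇒ `Δ^tp_{Y_N}` is the `N`-th-power locus for every `N`.**
[cite: MochizukiEtTh2009, §1 p.16] -/
theorem IsTateOrigin.dtpYN_eq {D : ThetaSetting p} (hT : D.IsTateOrigin) (hR2 : ∀ N : ℕ+, GtpYNFromCusp D N)
    (hcusp : ∃ Dc : Subgroup D.PiTemp, D.IsCuspidalDecompositionGroup Dc ∧ Dc ≤ D.GtpY) (N : ℕ+) :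
    D.DtpYN N = D.DtpY ⊓ (ellPowersY D N).comap (toEll D) := by
  obtain ⟨y₁, -, -, -, hy₁, -, -, -, -, ha, -, -, -⟩ := hT.tate N
  exact D.dtpYN_eq_dtpY_inf_comap_ellPowersY N hy₁ ha (hR2 N) hcusp

/-- **`IsTateOrigin` + R2 at level `N` ⇒ the inertia of every cusp of `Y` is an `N`-th power in `(Δ^tp_Y)^ell`.**
[cite: MochizukiEtTh2009, §1 p.13] -/
theorem IsTateOrigin.map_toEll_inertia_le_ellPowersY {D : ThetaSetting p} (hT : D.IsTateOrigin) (N : ℕ+)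
    (hR2 : GtpYNFromCusp D N) {Dc : Subgroup D.PiTemp} (hDc : D.IsCuspidalDecompositionGroup Dc)
    (hDcY : Dc ≤ D.GtpY) :
    (Dc ⊓ D.DeltaTemp).map (toEll D) ≤ ellPowersY D N := by
  obtain ⟨y₁, -, -, -, hy₁, -, -, -, -, ha, -, -, -⟩ := hT.tate N
  exact D.map_toEll_inertia_le_ellPowersY N hy₁ ha hR2 hDc hDcY

/-- **`IsTateOrigin` + R2 for every `N` ⇒ the inertia of every cusp of `Y` is ell-DIVISIBLE**: its ell-image lies in
`⨅_N N·(Δ^tp_Y)^ell`. [cite: MochizukiEtTh2009, §1 p.13] -/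
theorem IsTateOrigin.map_toEll_inertia_le_iInf_ellPowersY {D : ThetaSetting p} (hT : D.IsTateOrigin)
    (hR2 : ∀ N : ℕ+, GtpYNFromCusp D N) {Dc : Subgroup D.PiTemp} (hDc : D.IsCuspidalDecompositionGroup Dc)
    (hDcY : Dc ≤ D.GtpY) :
    (Dc ⊓ D.DeltaTemp).map (toEll D) ≤ ⨅ N : ℕ+, ellPowersY D N :=
  le_iInf fun N => hT.map_toEll_inertia_le_ellPowersY N (hR2 N) hDc hDcY

/-- **At a JOINT origin (`IsThm16Origin ∧ IsTateOrigin`) `Δ^tp_{Y_N}` is the `N`-th-power locus for every `N`** (R2 and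
the cusp come from `IsThm16Origin`, clause (a) from `IsTateOrigin`). [cite: MochizukiEtTh2009, §1 p.16] -/
theorem dtpYN_eq_of_origins {D : ThetaSetting p} (h16 : D.IsThm16Origin) (hT : D.IsTateOrigin) (N : ℕ+) :
    D.DtpYN N = D.DtpY ⊓ (ellPowersY D N).comap (toEll D) :=
  hT.dtpYN_eq h16.gtpYN_fromCusp h16.exists_cuspidal_le_GtpY N

/-- **At a JOINT origin the inertia of every cusp of `Y` is ell-divisible.** [cite: MochizukiEtTh2009, §1 p.13] -/
theorem map_toEll_inertia_le_iInf_ellPowersY_of_origins {D : ThetaSetting p} (h16 : D.IsThm16Origin)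
    (hT : D.IsTateOrigin) {Dc : Subgroup D.PiTemp} (hDc : D.IsCuspidalDecompositionGroup Dc) (hDcY : Dc ≤ D.GtpY) :
    (Dc ⊓ D.DeltaTemp).map (toEll D) ≤ ⨅ N : ℕ+, ellPowersY D N :=
  hT.map_toEll_inertia_le_iInf_ellPowersY h16.gtpYN_fromCusp hDc hDcY

/-- **From `IsThm16Origin` ALONE, at the level `N = 2` it carries ((TM₂), R2, its own cusp): `Δ^tp_Ÿ = Δ^tp_{Y₂}` is
the locus of squares** — `Δ^tp_{Y₂} = {y ∈ Δ^tp_Y | y^ell ∈ 2·(Δ^tp_Y)^ell}` («`Ÿ = Y₂`», p. 17).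
[cite: MochizukiEtTh2009, §1 p.17] -/
theorem IsThm16Origin.dtpYN_two_eq {D : ThetaSetting p} (h16 : D.IsThm16Origin) :
    D.DtpYN 2 = D.DtpY ⊓ (ellPowersY D 2).comap (toEll D) := by
  obtain ⟨y₁, -, -, -, hy₁, -, -, -, -, ha, -, -, -⟩ := h16.tate2
  exact D.dtpYN_eq_dtpY_inf_comap_ellPowersY 2 hy₁ ha (h16.gtpYN_fromCusp 2) h16.exists_cuspidal_le_GtpY

/-- **From `IsThm16Origin` ALONE: the inertia of every cusp of `Y` is a SQUARE in `(Δ^tp_Y)^ell`** (it dies in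
`Gal(Ÿ/Y) = (Δ^tp_Y)^ell ⊗ ℤ/2`). [cite: MochizukiEtTh2009, §1 p.17] -/
theorem IsThm16Origin.map_toEll_inertia_le_ellPowersY_two {D : ThetaSetting p} (h16 : D.IsThm16Origin)
    {Dc : Subgroup D.PiTemp} (hDc : D.IsCuspidalDecompositionGroup Dc) (hDcY : Dc ≤ D.GtpY) :
    (Dc ⊓ D.DeltaTemp).map (toEll D) ≤ ellPowersY D 2 := by
  obtain ⟨y₁, -, -, -, hy₁, -, -, -, -, ha, -, -, -⟩ := h16.tate2
  exact D.map_toEll_inertia_le_ellPowersY 2 hy₁ ha (h16.gtpYN_fromCusp 2) hDc hDcY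

/-! ### 5. Separated form: the inertia of a cusp lies in `Ker(Π^tp_X ↠ (Π^tp_X)^ell) = toHat⁻¹(closure [Δ_X, Δ_X])` -/

/-- **Separated form.** If no element of `(Δ^tp_Y)^ell` other than `1` is an `N`-th power for every `N` (`(Δ^tp_Y)^ell ≅
Ẑ(1)` has no divisible elements — the case at genuine data and at every `Ẑ`-coordinatised model of the cell), then at
`IsTateOrigin` + R2 for every `N` the inertia of every cusp of `Y` lies in the kernel of `Π^tp_X ↠ (Π^tp_X)^ell`.
[cite: MochizukiEtTh2009, §1 p.13] -/
theorem IsTateOrigin.inertia_le_ker_toEll_of_separated {D : ThetaSetting p} (hT : D.IsTateOrigin)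
    (hR2 : ∀ N : ℕ+, GtpYNFromCusp D N)
    (hsep : ∀ e ∈ D.DtpY.map (toEll D), (∀ N : ℕ+, e ∈ ellPowersY D N) → e = 1)
    {Dc : Subgroup D.PiTemp} (hDc : D.IsCuspidalDecompositionGroup Dc) (hDcY : Dc ≤ D.GtpY) :
    Dc ⊓ D.DeltaTemp ≤ (toEll D).ker := by
  intro g hg
  have hle := hT.map_toEll_inertia_le_iInf_ellPowersY hR2 hDc hDcY
  have hmem : toEll D g ∈ ⨅ N : ℕ+, ellPowersY D N := hle ⟨g, hg, rfl⟩
  rw [MonoidHom.mem_ker]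
  exact hsep _ ⟨g, ⟨hDcY hg.1, hg.2⟩, rfl⟩ fun N => (Subgroup.mem_iInf.mp hmem) N

/-- **… i.e. in `toHat⁻¹(closure [Δ_X, Δ_X])`** (root field `ker_toEll`: the kernel of `Π^tp_X ↠ (Π^tp_X)^ell` is induced by
`Δ_X ↠ Δ^ell_X = Δ_X/[Δ_X, Δ_X]`, p. 12) — the commutator axis of print. [cite: MochizukiEtTh2009, §1 p.12] -/
theorem IsTateOrigin.inertia_le_comap_commutator_of_separated {D : ThetaSetting p} (hT : D.IsTateOrigin)
    (hR2 : ∀ N : ℕ+, GtpYNFromCusp D N)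
    (hsep : ∀ e ∈ D.DtpY.map (toEll D), (∀ N : ℕ+, e ∈ ellPowersY D N) → e = 1)
    {Dc : Subgroup D.PiTemp} (hDc : D.IsCuspidalDecompositionGroup Dc) (hDcY : Dc ≤ D.GtpY) :
    Dc ⊓ D.DeltaTemp ≤
      (⁅D.DeltaHat, D.DeltaHat⁆.topologicalClosure).comap D.toHat.toMonoidHom := by
  rw [← D.ker_toEll]
  exact hT.inertia_le_ker_toEll_of_separated hR2 hsep hDc hDcY

/-- **Joint-origin form of §5**: at `IsThm16Origin ∧ IsTateOrigin` with separated `(Δ^tp_Y)^ell`, the inertia of every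
cusp of `Y` lies in `toHat⁻¹(closure [Δ_X, Δ_X])`. [cite: MochizukiEtTh2009, §1 p.12] -/
theorem inertia_le_comap_commutator_of_origins_of_separated {D : ThetaSetting p} (h16 : D.IsThm16Origin)
    (hT : D.IsTateOrigin)
    (hsep : ∀ e ∈ D.DtpY.map (toEll D), (∀ N : ℕ+, e ∈ ellPowersY D N) → e = 1)
    {Dc : Subgroup D.PiTemp} (hDc : D.IsCuspidalDecompositionGroup Dc) (hDcY : Dc ≤ D.GtpY) :
    Dc ⊓ D.DeltaTemp ≤
      (⁅D.DeltaHat, D.DeltaHat⁆.topologicalClosure).comap D.toHat.toMonoidHom :=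
  hT.inertia_le_comap_commutator_of_separated h16.gtpYN_fromCusp hsep hDc hDcY

end ThetaSetting

end Literature.AnabelianGeometry.EtaleTheta

end
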